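import Summits.CriticalPhenomena.PercolationContinuityZ3.Theorems.PercNearOneGluingNoHeavyLowerTailSahiLatinKernel
import Summits.CriticalPhenomena.PercolationContinuityZ3.Theorems.PercNearOneGluingNoHeavyLowerTailAntipodalHarris

/-!
# `NoHeavyLowerTail` (crux stmt-CriticalPhenomena-4575), Sahi programme (prim-master-conj gen 42): the MOVE LEMMAS R and A for the
# Latin kernel `κ_d` in EVERY dimension — single-point moves are signed by the Venn cell of the point

Support file (`--supports stmt-CriticalPhenomena-4575`; companion of `…SahiLatinKernel`).  Memo
`run/shared/lean/prim/prim-l12/FROM-prim-master-conj-g41-DESCENT.md` §1 (paper proofs, here formalised verbatim).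

With the closed form `Φ_{bc}(u) = 2^{d+1}[u∈b][u∈c] − N_{b∩c}(u) − [u∈c]N_b(u) − [u∈b]N_c(u) + Λ_{bc}(u)` (`SahiLatin.Phi_eq`) of the
charge (= the change of `κ(a,b,c)` when the point `u` is added to `a`):
* **LEMMA R** (`Phi_nonneg_of_mem`; no monotonicity needed): if `u ∈ b ∩ c` then `Φ_{bc}(u) ≥ 2^d − N_{b∩c}(u) ≥ 0` — Bonferroni on
  the link, `Λ_{bc} = |b_u ∩ (c_u)^*| ≥ N_b + N_c − 2^d` (`N_add_N_le_Lam_add`; `(c_u)^*` = antipodal image, same size,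
  `card_filter_anti_mem`);
* **LEMMA A** (`Phi_nonpos_of_not_mem`): if `b, c` are UP-sets and `u ∉ b ∩ c` then `Φ_{bc}(u) ≤ Λ_{bc}(u) − N_{b∩c}(u) ≤ 0` — the
  ANTIPODAL HARRIS inequality on the link (`Lam_le_N`): the link `{y : ∀ i, y i ≠ u i}` with the induced order is the Boolean lattice
  `2^ι` (`toSet`/`ofSet`: a link point ↦ the set of axes where it takes the upper of its two admissible levels; `anti u` ↦ complement),
  the traces of up-sets are up-set families (`isUpperSet_fam`), and the tree's `AntipodalHarris.card_inter_antipode_le`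
  (`#(𝒜 ∩ σℬ) ≤ #(𝒜 ∩ ℬ)` for up-set families, = Harris–Kleitman twice) is exactly `Λ ≤ N`.
Consequences for `κ` (`…SahiLatinKernel.kappa_insert`): removing from `a` a point of `b ∩ c` never increases `κ(a,b,c)`
(`kappa_erase_le`), adding to `a` a point outside `b ∩ c` never increases it (`kappa_insert_le`); the same in the other two slots by
the slot symmetry of `κ`.  Up-set bookkeeping for the descent (`isUpperSet_erase_of_minimal`, `isUpperSet_insert_of_maximal`) is
included.  Everything proved; axioms standard.
-/

namespace Summit.CriticalPhenomena.PercolationContinuityZ3.Theorems.SahiLatin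

open Finset

variable {ι : Type*} [Fintype ι] [DecidableEq ι]

/-! ## Lemma R: Bonferroni on the link -/

/-- The antipode is a bijection of the link: `#{y ∈ link u : anti u y ∈ c} = N_c(u)`. [this work] -/
theorem card_filter_anti_mem (c : Finset (Pt ι)) (u : Pt ι) : ((link u).filter fun y => anti u y ∈ c).card = N c u := by
  have h : (link u).filter (fun y => anti u y ∈ c) = ((link u).filter fun y => y ∈ c).image (anti u) := by
    ext y
    simp only [mem_filter, mem_image]
    constructor
    · rintro ⟨hy, hc⟩
      exact ⟨anti u y, ⟨anti_mem_link hy, hc⟩, anti_anti u y⟩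
    · rintro ⟨z, ⟨hz, hzc⟩, rfl⟩
      exact ⟨anti_mem_link hz, by rw [anti_anti]; exact hzc⟩
  rw [N, h, card_image_of_injective _ (anti_injective u)]

/-- Bonferroni on the link: `N_b(u) + N_c(u) ≤ Λ_{bc}(u) + 2^d`. [this work] -/
theorem N_add_N_le_Lam_add (b c : Finset (Pt ι)) (u : Pt ι) : N b u + N c u ≤ Lam b c u + 2 ^ Fintype.card ι := by
  set B := (link u).filter fun y => y ∈ b with hBdef
  set C := (link u).filter fun y => anti u y ∈ c with hCdef
  have hBC : B ∩ C = (link u).filter fun y => y ∈ b ∧ anti u y ∈ c := by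
    rw [hBdef, hCdef, ← filter_and]
  have hunion : (B ∪ C).card ≤ 2 ^ Fintype.card ι := by
    rw [← card_link u]
    exact card_le_card (union_subset (filter_subset _ _) (filter_subset _ _))
  have h := card_union_add_card_inter B C
  rw [hBC] at h
  have hB : B.card = N b u := rfl
  have hC : C.card = N c u := card_filter_anti_mem c u
  rw [Lam]
  omega

/-- **LEMMA R** (all `d`; no monotonicity needed).  A point of `b ∩ c` has nonnegative charge: `0 ≤ Φ_{bc}(u)`
(indeed `Φ ≥ 2^d − N_{b∩c}(u)`). [this work] -/
theorem Phi_nonneg_of_mem (b c : Finset (Pt ι)) {u : Pt ι} (hb : u ∈ b) (hc : u ∈ c) : 0 ≤ Phi b c u := by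
  rw [Phi_eq, ind_of_mem hb, ind_of_mem hc]
  have h1 : (N b u : ℤ) + N c u ≤ Lam b c u + 2 ^ Fintype.card ι := by exact_mod_cast N_add_N_le_Lam_add b c u
  have h2 : (N (b ∩ c) u : ℤ) ≤ 2 ^ Fintype.card ι := by exact_mod_cast N_le (b ∩ c) u
  rw [pow_succ]
  linarith

/-! ## The link as the Boolean lattice `2^ι` -/

/-- The upper of the two levels different from `v`. [this work] -/
def hi (v : Fin 3) : Fin 3 := if v = 2 then 1 else 2

/-- The lower of the two levels different from `v`. [this work] -/
def lo (v : Fin 3) : Fin 3 := if v = 0 then 1 else 0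

/-- `lo v ≠ v` (finite check). [this work] -/
theorem lo_ne : ∀ v : Fin 3, lo v ≠ v := by decide

/-- `hi v ≠ v` (finite check). [this work] -/
theorem hi_ne : ∀ v : Fin 3, hi v ≠ v := by decide

/-- `lo v ≠ hi v` (finite check). [this work] -/
theorem lo_ne_hi : ∀ v : Fin 3, lo v ≠ hi v := by decide

/-- A level different from `v` is `lo v` or `hi v` (finite check). [this work] -/
theorem eq_lo_or_eq_hi : ∀ v w : Fin 3, w ≠ v → w = lo v ∨ w = hi v := by decide

/-- A level different from `v` is at most `hi v` (finite check). [this work] -/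
theorem le_hi_of_ne : ∀ v w : Fin 3, w ≠ v → w ≤ hi v := by decide

/-- A level different from `v` is at least `lo v` (finite check). [this work] -/
theorem lo_le_of_ne : ∀ v w : Fin 3, w ≠ v → lo v ≤ w := by decide

/-- The third level after `v` and `hi v` is `lo v` (finite check). [this work] -/
theorem third_hi : ∀ v : Fin 3, -(v + hi v) = lo v := by decide

/-- The third level after `v` and `lo v` is `hi v` (finite check). [this work] -/
theorem third_lo : ∀ v : Fin 3, -(v + lo v) = hi v := by decide

/-- Encode a point by the set of axes on which it takes the upper admissible level. [this work] -/
def toSet (u y : Pt ι) : Finset ι := univ.filter fun i => y i = hi (u i)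

/-- Decode a set of axes to a link point. [this work] -/
def ofSet (u : Pt ι) (S : Finset ι) : Pt ι := fun i => if i ∈ S then hi (u i) else lo (u i)

omit [DecidableEq ι] in
/-- Membership in `toSet`. [this work] -/
@[simp] theorem mem_toSet {u y : Pt ι} {i : ι} : i ∈ toSet u y ↔ y i = hi (u i) := by
  simp [toSet]

/-- Decoded points lie in the link. [this work] -/
theorem ofSet_mem_link (u : Pt ι) (S : Finset ι) : ofSet u S ∈ link u := by
  rw [mem_link]; intro i
  by_cases h : i ∈ S
  · simp only [ofSet, h, if_true]; exact hi_ne _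
  · simp only [ofSet, h, if_false]; exact lo_ne _

/-- `toSet ∘ ofSet = id`. [this work] -/
@[simp] theorem toSet_ofSet (u : Pt ι) (S : Finset ι) : toSet u (ofSet u S) = S := by
  ext i
  rw [mem_toSet]
  by_cases h : i ∈ S
  · simp [ofSet, h]
  · simp only [ofSet, h, if_false, iff_false]; exact lo_ne_hi _

/-- `ofSet ∘ toSet = id` on the link. [this work] -/
theorem ofSet_toSet {u y : Pt ι} (hy : y ∈ link u) : ofSet u (toSet u y) = y := by
  rw [mem_link] at hy
  funext i
  by_cases h : y i = hi (u i)
  · have : i ∈ toSet u y := mem_toSet.2 h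
    simp only [ofSet, this, if_true, h]
  · have hn : i ∉ toSet u y := fun hm => h (mem_toSet.1 hm)
    simp only [ofSet, hn, if_false]
    rcases eq_lo_or_eq_hi (u i) (y i) (hy i) with h' | h'
    · exact h'.symm
    · exact absurd h' h

/-- `toSet u` is injective on the link. [this work] -/
theorem toSet_injOn (u : Pt ι) : Set.InjOn (toSet u) (link u : Set (Pt ι)) := by
  intro y hy y' hy' h
  rw [Finset.mem_coe] at hy hy'
  rw [← ofSet_toSet hy, ← ofSet_toSet hy', h]

omit [Fintype ι] in
/-- Decoding is monotone. [this work] -/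
theorem ofSet_mono (u : Pt ι) {S T : Finset ι} (h : S ⊆ T) : ofSet u S ≤ ofSet u T := by
  intro i
  by_cases hS : i ∈ S
  · simp only [ofSet, hS, h hS, if_true]; exact le_rfl
  · simp only [ofSet, hS, if_false]
    split_ifs
    · exact (le_hi_of_ne (u i) (lo (u i)) (lo_ne _))
    · exact le_rfl

/-- Decoding the complement is the antipode. [this work] -/
theorem ofSet_compl (u : Pt ι) (S : Finset ι) : ofSet u Sᶜ = anti u (ofSet u S) := by
  funext i
  by_cases h : i ∈ S
  · have : i ∉ Sᶜ := by simp [h]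
    simp only [ofSet, this, if_false, anti, h, if_true]; exact (third_hi _).symm
  · have : i ∈ Sᶜ := by simp [h]
    simp only [ofSet, this, if_true, anti, h, if_false]; exact (third_lo _).symm

/-- The trace of `s` on the link of `u`, encoded as a family of subsets of `ι`. [this work] -/
def fam (u : Pt ι) (s : Finset (Pt ι)) : Finset (Finset ι) := ((link u).filter fun y => y ∈ s).image (toSet u)

/-- Membership in the encoded trace. [this work] -/
theorem mem_fam {u : Pt ι} {s : Finset (Pt ι)} {S : Finset ι} : S ∈ fam u s ↔ ofSet u S ∈ s := by
  rw [fam, mem_image]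
  constructor
  · rintro ⟨y, hy, rfl⟩
    rw [mem_filter] at hy
    rw [ofSet_toSet hy.1]; exact hy.2
  · intro h
    exact ⟨ofSet u S, mem_filter.2 ⟨ofSet_mem_link u S, h⟩, toSet_ofSet u S⟩

/-- The encoded trace has `N_s(u)` members. [this work] -/
theorem card_fam (u : Pt ι) (s : Finset (Pt ι)) : (fam u s).card = N s u := by
  rw [fam, N, card_image_of_injOn]
  exact fun y hy y' hy' h => toSet_injOn u (mem_filter.1 hy).1 (mem_filter.1 hy').1 h

/-- The trace of an UP-set is an up-set family of `2^ι`. [this work] -/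
theorem isUpperSet_fam (u : Pt ι) {s : Finset (Pt ι)} (hs : IsUpperSet (s : Set (Pt ι))) :
    IsUpperSet (fam u s : Set (Finset ι)) := by
  intro S T hST hS
  rw [Finset.mem_coe, mem_fam] at hS ⊢
  exact hs (ofSet_mono u hST) hS

/-- Traces commute with intersection. [this work] -/
theorem fam_inter (u : Pt ι) (b c : Finset (Pt ι)) : fam u b ∩ fam u c = fam u (b ∩ c) := by
  ext S; simp only [mem_inter, mem_fam]

/-- The antipodal count through the encoding: `#(fam b ∩ σ(fam c)) = Λ_{bc}(u)`. [this work] -/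
theorem card_fam_inter_antipode (u : Pt ι) (b c : Finset (Pt ι)) :
    (fam u b ∩ AntipodalHarris.antipode (fam u c)).card = Lam b c u := by
  have h : fam u b ∩ AntipodalHarris.antipode (fam u c) = ((link u).filter fun y => y ∈ b ∧ anti u y ∈ c).image (toSet u) := by
    ext S
    simp only [mem_inter, AntipodalHarris.mem_antipode, mem_fam, mem_image, mem_filter, ofSet_compl]
    constructor
    · rintro ⟨hb, hc⟩
      exact ⟨ofSet u S, ⟨ofSet_mem_link u S, hb, hc⟩, toSet_ofSet u S⟩
    · rintro ⟨y, ⟨hy, hb, hc⟩, rfl⟩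
      rw [ofSet_toSet hy]; exact ⟨hb, hc⟩
  rw [h, Lam, card_image_of_injOn]
  exact fun y hy y' hy' h => toSet_injOn u (mem_filter.1 hy).1 (mem_filter.1 hy').1 h

/-- **Antipodal Harris on the link**: for up-sets `b, c`, `Λ_{bc}(u) ≤ N_{b∩c}(u)`. [this work] -/
theorem Lam_le_N {b c : Finset (Pt ι)} (hb : IsUpperSet (b : Set (Pt ι))) (hc : IsUpperSet (c : Set (Pt ι))) (u : Pt ι) :
    Lam b c u ≤ N (b ∩ c) u := by
  rw [← card_fam_inter_antipode, ← card_fam, ← fam_inter]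
  exact AntipodalHarris.card_inter_antipode_le (isUpperSet_fam u hb) (isUpperSet_fam u hc)

/-- **LEMMA A** (all `d`).  For up-sets `b, c`, a point NOT in `b ∩ c` has nonpositive charge: `Φ_{bc}(u) ≤ 0`
(indeed `Φ ≤ Λ_{bc}(u) − N_{b∩c}(u)`). [this work] -/
theorem Phi_nonpos_of_not_mem {b c : Finset (Pt ι)} (hb : IsUpperSet (b : Set (Pt ι))) (hc : IsUpperSet (c : Set (Pt ι)))
    {u : Pt ι} (hu : ¬ (u ∈ b ∧ u ∈ c)) : Phi b c u ≤ 0 := by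
  have hL : (Lam b c u : ℤ) ≤ N (b ∩ c) u := by exact_mod_cast Lam_le_N hb hc u
  have hNb : (0 : ℤ) ≤ N b u := Nat.cast_nonneg _
  have hNc : (0 : ℤ) ≤ N c u := Nat.cast_nonneg _
  rw [Phi_eq]
  by_cases hub : u ∈ b
  · have huc : u ∉ c := fun h => hu ⟨hub, h⟩
    rw [ind_of_mem hub, ind_of_not_mem huc]
    linarith
  · rw [ind_of_not_mem hub]
    by_cases huc : u ∈ c
    · rw [ind_of_mem huc]; linarith
    · rw [ind_of_not_mem huc]; linarith

/-! ## Consequences for `κ`: the signed single-point moves -/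

/-- R-move in the first slot: removing from `a` a point of `b ∩ c` does not increase `κ`. [this work] -/
theorem kappa_erase_le {a b c : Finset (Pt ι)} {m : Pt ι} (hma : m ∈ a) (hmb : m ∈ b) (hmc : m ∈ c) :
    kappa (a.erase m) b c ≤ kappa a b c := by
  rw [kappa_eq_kappa_erase_add hma]
  have := Phi_nonneg_of_mem b c hmb hmc
  linarith

/-- A-move in the first slot: for up-sets `b, c`, adding to `a` a point outside `b ∩ c` does not increase `κ`. [this work] -/
theorem kappa_insert_le {a b c : Finset (Pt ι)} (hb : IsUpperSet (b : Set (Pt ι))) (hc : IsUpperSet (c : Set (Pt ι)))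
    {m : Pt ι} (hma : m ∉ a) (hm : ¬ (m ∈ b ∧ m ∈ c)) : kappa (insert m a) b c ≤ kappa a b c := by
  rw [kappa_insert hma]
  have := Phi_nonpos_of_not_mem hb hc hm
  linarith

/-- R-move in the second slot. [this work] -/
theorem kappa_erase_le₂ {a b c : Finset (Pt ι)} {m : Pt ι} (hmb : m ∈ b) (hma : m ∈ a) (hmc : m ∈ c) :
    kappa a (b.erase m) c ≤ kappa a b c := by
  rw [kappa_swap12 a (b.erase m), kappa_swap12 a b]
  exact kappa_erase_le hmb hma hmc

/-- R-move in the third slot. [this work] -/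
theorem kappa_erase_le₃ {a b c : Finset (Pt ι)} {m : Pt ι} (hmc : m ∈ c) (hma : m ∈ a) (hmb : m ∈ b) :
    kappa a b (c.erase m) ≤ kappa a b c := by
  rw [kappa_swap13 a b (c.erase m), kappa_swap13 a b c]
  exact kappa_erase_le hmc hmb hma

/-- A-move in the second slot. [this work] -/
theorem kappa_insert_le₂ {a b c : Finset (Pt ι)} (ha : IsUpperSet (a : Set (Pt ι))) (hc : IsUpperSet (c : Set (Pt ι)))
    {m : Pt ι} (hmb : m ∉ b) (hm : ¬ (m ∈ a ∧ m ∈ c)) : kappa a (insert m b) c ≤ kappa a b c := by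
  rw [kappa_swap12 a (insert m b), kappa_swap12 a b]
  exact kappa_insert_le ha hc hmb hm

/-- A-move in the third slot. [this work] -/
theorem kappa_insert_le₃ {a b c : Finset (Pt ι)} (ha : IsUpperSet (a : Set (Pt ι))) (hb : IsUpperSet (b : Set (Pt ι)))
    {m : Pt ι} (hmc : m ∉ c) (hm : ¬ (m ∈ a ∧ m ∈ b)) : kappa a b (insert m c) ≤ kappa a b c := by
  rw [kappa_swap13 a b (insert m c), kappa_swap13 a b c]
  exact kappa_insert_le hb ha hmc fun h => hm ⟨h.2, h.1⟩

/-! ## Up-set bookkeeping for the moves -/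

omit [DecidableEq ι] in
/-- Removing a MINIMAL element of an up-set leaves an up-set. [this work] -/
theorem isUpperSet_erase_of_minimal {a : Finset (Pt ι)} (ha : IsUpperSet (a : Set (Pt ι))) {m : Pt ι}
    (hmin : ∀ y ∈ a, y ≤ m → y = m) : IsUpperSet ((a.erase m : Finset (Pt ι)) : Set (Pt ι)) := by
  intro x y hxy hx
  rw [Finset.mem_coe, mem_erase] at hx ⊢
  refine ⟨fun hym => ?_, ha hxy hx.2⟩
  subst hym
  exact hx.1 (hmin x hx.2 hxy)

omit [DecidableEq ι] in
/-- Adding a MAXIMAL non-element (every strictly larger point lies in the set) to an up-set leaves an up-set. [this work] -/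
theorem isUpperSet_insert_of_maximal {a : Finset (Pt ι)} (ha : IsUpperSet (a : Set (Pt ι))) {m : Pt ι}
    (hmax : ∀ y, m ≤ y → y ≠ m → y ∈ a) : IsUpperSet ((insert m a : Finset (Pt ι)) : Set (Pt ι)) := by
  intro x y hxy hx
  rw [Finset.mem_coe, mem_insert] at hx ⊢
  rcases hx with rfl | hx
  · by_cases h : y = x
    · exact Or.inl h
    · exact Or.inr (hmax y hxy h)
  · exact Or.inr (ha hxy hx)

end Summit.CriticalPhenomena.PercolationContinuityZ3.Theorems.SahiLatin
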